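import Summits.BirchSwinnertonDyer.BirchSwinnertonDyer.Theorems.GoldfeldAllTwistsTwoConverseTwinHalfTraceSevenModEightHalfTrace
import Summits.BirchSwinnertonDyer.BirchSwinnertonDyer.Theorems.GoldfeldAllTwistsTwoConverseTwinGenusSquaresOddNegEight
import HarnessLib

set_option linter.dupNamespace false
set_option autoImplicit false

/-!
# LINE B49, family F3 (`d_K = −8ℓ`), quarter `ℓ ≡ 3 (mod 8)`: the HALF-TRACE CONJUGATION LAW `Ψ⁻ + τΨ⁻ = T` in `X₀(49)(K[1])`
# (input (B1) of the torsion branch of THEOREM A‴, `…TwinHalfTraceThreeModEightCore`)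

Cell `bsd-goldfeld`, seat `bsd-goldfeld-s1p-c3x` (prover, gen 3); planner g38 RULINGS (cxliv)/(cxlv), ORDER «A‴-F3|ℓ≡3(8)», file K5 of
memo `HOME/F3-ETA-DESCENT.md` §8; `--supports stmt-BirchSwinnertonDyer-19350`. Theses-free; theorems only; NO definition, NO fact.
The `ℓ ≡ 3 (mod 8)` twin of gen 0's `…TwinHalfTraceSevenModEightHalfTrace.lean` (`Ψ⁻ + τΨ⁻ = O` for `ℓ ≡ 7 (mod 8)`): SAME proof
(Shimura reciprocity read in `K[1]`, the coset `Cl²γ₀` of the non-principal genus, ty's FILE D `conjPoint_sum_φ_heegnerTau_sqCoset`,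
BY NAME; §1 counting lemma `card_filter_sqCoset_eq_natCard_range` of gen 0 BY NAME), with the ONE change that the number of terms
`#(Cl²γ₀) = #Cl²` is now ODD, so `#·φ(0) = #·T = T` instead of `O`. §1 states the law for ANY `d_K = −8ℓ` under the two class-group
inputs as hypotheses (`[Cl : Cl²] = 2`, `#Cl²` odd); §2 discharges them for `ℓ ≡ 3 (mod 8)` from GENUS-SQUARES-ODD(−8ℓ)
(`…TwinGenusSquaresOddNegEight`, this seat, K4).

HONEST FRAMING: BSD is not proved here; the two named inputs are the root number `w(49a1) = +1` (`hw`) and (T-φ0) `φ₀(0) = T` (`h0`),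
exactly as in gen 0; everything else is PROVED in the tree and CITED. Density-zero family; item 19350 unchanged.

## The argument (Gross 1984 §5 / Gross 1991 Prop. 5.3, summed over the non-principal genus)

`K = ℚ(√−2ℓ)`, `r₀ = √−ℓ ∈ K[1]`, `G = Gal(K[1]/K) ≅ Cl` (`Θ`), `y₁ = y(1)`, `Ψ⁻ = Σ_{σ r₀ = −r₀} σy₁ = Σ_{[𝔞_Q] ∈ Cl²γ₁} φ(τ_Q) =: z`
in `E(ℂ)`; FILE D: `z̄ = −z + #(Cl²γ₀)·φ(0)` (Fricke sign `−w = −1`), `#(Cl²γ₀) = #Cl²` ODD and `φ(0) = T`, `2T = O`: `z̄ = −z + T`;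
complex conjugation `τ` of `K[1] ⊂ ℂ` acts as `z ↦ z̄`; injectivity of `E(K[1]) → E(ℂ)` gives `Ψ⁻ + τΨ⁻ = T`.

References: B. Gross, *Heegner points on X₀(N)* (1984) §5 [Gross1984]; B. Gross, LMS LN 153 (1991) Prop. 5.3 [GrossLMS1991];
H. Darmon, CBMS 101 (2004) Thm 3.7, Prop. 3.11 [Darmon2004]; D. Cox, *Primes of the form x² + ny²* (2013) Thm 3.15 [Cox2013].
-/

noncomputable section

open scoped Classical

open WeierstrassCurve Literature.NumberTheory.EllipticCurves Literature.NumberTheory.EllipticCurves.ModularForms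
  Literature.NumberTheory.EllipticCurves.CoatesLiTianZhai2015 Literature.Computability.Cryptography.Hallgren2005

namespace Summit.BirchSwinnertonDyer.BirchSwinnertonDyer.Theorems.GoldfeldGoodTwists

/-! ## §1 The half-trace conjugation law with an ODD number of cusp terms -/

section HalfTrace

variable {K : Type} [Field K] [NumberField K]

variable (ι : K →+* ℂ) [FiniteDimensional K (ringClassField K ι 1)] [IsGalois K (ringClassField K ι 1)]

/-- **THE HALF-TRACE CONJUGATION LAW, odd case: `Ψ⁻ + τΨ⁻ = T`** in `X₀(49)(K[1])`, `K = ℚ(√−2ℓ)`, `ℓ` prime with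
`(ℓ/7) = −1`, `r₀ = √−ℓ ∈ K[1]`, `Ψ⁻ = Σ_{σ ∈ Gal(K[1]/K), σ r₀ = −r₀} σ·y(1)` the half-trace of the conductor-one Heegner point
over the non-principal genus, `τ` = complex conjugation, UNDER THE HYPOTHESES `[Cl : Cl²] = 2` (`hidx`) and `#Cl²` ODD (`hodd`)
(both discharged for `ℓ ≡ 3 (mod 8)` in §2); stated for any `DecidableEq K[1]`. Inputs BY NAME: `w(49a1) = +1` (`hw`), (T-φ0) (`h0`);
CITED theorems: Shimura reciprocity (ty), Gross's summed reflection law over `Cl²γ₀` (ty's FILE D), gen 0's counting lemma.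
[cite: Gross1984, §5 (5.2)–(5.3)] [cite: GrossLMS1991, Prop. 5.3] [cite: Darmon2004, Thm. 3.7 and Prop. 3.11] [cite: Cox2013, §3.B Thm. 3.15] -/
theorem halfTrace_add_map_conj_eq_twoTorsion_of_odd (hK : IsImaginaryQuadratic K) {l : ℕ} (hl : l.Prime)
    (hl7 : jacobiSym l 7 = -1) (hdK : NumberField.discr K = -(8 * (l : ℤ))) {N : ℕ} [NeZero N] (hN : cm7.conductorNorm ℤ = N)
    (D₀ : ModularParametrizationData cm7 N) (hw : cm7.rootNumber = 1) (h0 : ∃ h, D₀.cuspZeroPoint = Affine.Point.some 2 (-1) h)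
    {β : ℤ} (d : KolyvaginHeegnerData D₀ β ι 1) {r₀ : ringClassField K ι 1} (hr : (r₀ : ℂ) ^ 2 = -(l : ℂ))
    (τ : ringClassField K ι 1 ≃ₐ[ℚ] ringClassField K ι 1)
    (hτ : ∀ x : ringClassField K ι 1, ((τ x : ringClassField K ι 1) : ℂ) = starRingEnd ℂ x)
    (hidx : (powMonoidHom 2 : ClassGroup (OrderCl.QO hK.negDiscr) →* ClassGroup (OrderCl.QO hK.negDiscr)).range.index = 2)
    (hodd : Odd (Nat.card (powMonoidHom 2 : ClassGroup (OrderCl.QO hK.negDiscr) →* ClassGroup (OrderCl.QO hK.negDiscr)).range))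
    [hdec : DecidableEq (ringClassField K ι 1)] :
    (∑ σ : ringClassField K ι 1 ≃ₐ[K] ringClassField K ι 1,
        (if σ r₀ = r₀ then (0 : ℤ) else 1) • Affine.Point.map (σ : ringClassField K ι 1 →ₐ[K] ringClassField K ι 1) d.y) +
      Affine.Point.map (τ : ringClassField K ι 1 →ₐ[ℚ] ringClassField K ι 1)
        (∑ σ : ringClassField K ι 1 ≃ₐ[K] ringClassField K ι 1,
          (if σ r₀ = r₀ then (0 : ℤ) else 1) • Affine.Point.map (σ : ringClassField K ι 1 →ₐ[K] ringClassField K ι 1) d.y) =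
      Affine.Point.some 2 (-1) (nonsingular_cm7_baseChange_two_neg_one (ringClassField K ι 1)) := by
  -- one decidability world (the statement adapts to the caller's `DecidableEq K[1]`; the proof runs in the tree's default one)
  have hworld : hdec = fun a b ↦ Subtype.instDecidableEq a b := Subsingleton.elim _ _
  subst hworld
  subst hN
  ------------------------------------------------------------------ data: level, Heegner datum, lift family, Θ, q₁
  have hH : SatisfiesHeegnerHypothesis (cm7.conductorNorm ℤ) K := by
    rw [conductorNorm_cm7]; exact satisfiesHeegnerHypothesis_fortyNine_negEightMul hK hl7 hdK
  have hND : ∀ p : ℕ, p.Prime → p ∣ cm7.conductorNorm ℤ → ¬ (p : ℤ) ∣ NumberField.discr K :=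
    fun p hp hpN ↦ not_dvd_discr_of_satisfiesHeegnerHypothesis hK hH hp hpN
  obtain ⟨H, hHβ⟩ := nonempty_heegnerDatum_holds (cm7.conductorNorm ℤ) K hK d.dvd_sq_sub
  obtain ⟨P, Θ, hPφ, hΘ⟩ := exists_shimuraReciprocity_ringClassField_one hK hH D₀ H ι
  obtain ⟨q₁, hy⟩ := exists_rep_y_eq_of_kolyvaginHeegnerData hK d H hHβ hPφ
  -- `σ y₁ = P_{q(σ)}`, `[𝔞_{q(σ)}] = Θ⁻¹σ · [𝔞_{q₁}]`
  choose qσ hqσ using fun σ : ringClassField K ι 1 ≃ₐ[K] ringClassField K ι 1 ↦ hΘ (Θ.symm σ) q₁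
  have hqσ_map : ∀ σ : ringClassField K ι 1 ≃ₐ[K] ringClassField K ι 1,
      Affine.Point.map (σ : ringClassField K ι 1 →ₐ[K] ringClassField K ι 1) d.y = P (qσ σ) := fun σ ↦ by
    have h := (hqσ σ).2
    rw [MulEquiv.apply_symm_apply] at h
    rw [hy]; exact h
  ------------------------------------------------------------------ the genus character on `Gal(K[1]/K)`
  have hrK := sq_eq_algebraMap_neg_natCast (ι := ι) hr
  have hd : ¬ IsSquare (-(l : K)) := not_isSquare_neg_natCast_of_discr_eq_negEightPrime hK hl hdK
  have hχ : ∀ σ : ringClassField K ι 1 ≃ₐ[K] ringClassField K ι 1,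
      σ r₀ = r₀ ↔ Θ.symm σ ∈ (powMonoidHom 2 : _ →* ClassGroup (OrderCl.QO hK.negDiscr)).range :=
    algEquiv_apply_sqrt_eq_iff_symm_mem_range_sq Θ hidx hrK hd
  obtain ⟨σ₀, hσ₀⟩ := exists_algEquiv_apply_sqrt_eq_neg hrK hd
  have hr0 : -r₀ ≠ r₀ := by
    intro h
    have h0' : r₀ = 0 := add_self_eq_zero.mp (neg_eq_iff_add_eq_zero.mp h)
    have h3 := hr
    rw [h0'] at h3
    push_cast at h3
    have : (l : ℂ) ≠ 0 := by exact_mod_cast hl.ne_zero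
    exact this (by rw [zero_pow two_ne_zero] at h3; exact neg_eq_zero.mp h3.symm)
  have hγ₁ : Θ.symm σ₀ ∉ (powMonoidHom 2 : _ →* ClassGroup (OrderCl.QO hK.negDiscr)).range :=
    fun h ↦ hr0 (hσ₀ ▸ (hχ σ₀).mpr h)
  -- `σ r₀ ≠ r₀ ⟺ [𝔞_{q(σ)}] ∈ Cl² · γ₀`, `γ₀ = Θ⁻¹σ₀ · [𝔞_{q₁}]`
  set γ₀ : ClassGroup (OrderCl.QO hK.negDiscr) := Θ.symm σ₀ * heegnerFormClass hK (q₁ : ℤ × ℤ × ℤ) with hγ₀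
  have hcoset : ∀ σ : ringClassField K ι 1 ≃ₐ[K] ringClassField K ι 1,
      σ r₀ ≠ r₀ ↔ ∃ δ, heegnerFormClass hK (qσ σ : ℤ × ℤ × ℤ) = δ ^ 2 * γ₀ := fun σ ↦ by
    rw [(hqσ σ).1, hγ₀, Ne, hχ σ]
    constructor
    · intro hσ
      have hmul : Θ.symm σ * (Θ.symm σ₀)⁻¹ ∈ (powMonoidHom 2 : _ →* ClassGroup (OrderCl.QO hK.negDiscr)).range := by
        rw [Subgroup.mul_mem_iff_of_index_two hidx, Subgroup.inv_mem_iff]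
        exact ⟨fun h ↦ absurd h hσ, fun h ↦ absurd h hγ₁⟩
      obtain ⟨δ, hδ⟩ := hmul
      refine ⟨δ, ?_⟩
      rw [← mul_assoc, ← powMonoidHom_apply, hδ, inv_mul_cancel_right]
    · rintro ⟨δ, hδ⟩ hmem
      have hδ' : Θ.symm σ = δ ^ 2 * Θ.symm σ₀ := by
        rw [← mul_assoc] at hδ; exact mul_right_cancel hδ
      apply hγ₁
      have : Θ.symm σ₀ = (δ ^ 2)⁻¹ * Θ.symm σ := by rw [hδ', inv_mul_cancel_left]
      rw [this]
      exact mul_mem (inv_mem ⟨δ, rfl⟩) hmem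
  ------------------------------------------------------------------ the complex point of `Ψ⁻` is the coset sum `z`
  have hinjq : ∀ σ σ' : ringClassField K ι 1 ≃ₐ[K] ringClassField K ι 1, qσ σ = qσ σ' → σ = σ' := by
    intro σ σ' h
    have h1 := (hqσ σ).1
    rw [h, (hqσ σ').1] at h1
    exact Θ.symm.injective (mul_right_cancel h1).symm
  have hsum : Affine.Point.map (ringClassField K ι 1).subtype.toRatAlgHom
      (∑ σ : ringClassField K ι 1 ≃ₐ[K] ringClassField K ι 1,
        (if σ r₀ = r₀ then (0 : ℤ) else 1) • Affine.Point.map (σ : ringClassField K ι 1 →ₐ[K] ringClassField K ι 1) d.y) =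
      ∑ Q ∈ H.reps.filter (fun Q ↦ ∃ δ, heegnerFormClass hK Q = δ ^ 2 * γ₀), D₀.φ (heegnerTau Q) := by
    rw [map_sum]
    have h1 : ∀ σ : ringClassField K ι 1 ≃ₐ[K] ringClassField K ι 1,
        Affine.Point.map (ringClassField K ι 1).subtype.toRatAlgHom
          ((if σ r₀ = r₀ then (0 : ℤ) else 1) • Affine.Point.map (σ : ringClassField K ι 1 →ₐ[K] ringClassField K ι 1) d.y) =
        if σ r₀ ≠ r₀ then D₀.φ (heegnerTau (qσ σ : ℤ × ℤ × ℤ)) else 0 := fun σ ↦ by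
      rw [map_zsmul, hqσ_map, hPφ]
      by_cases h : σ r₀ = r₀
      · rw [if_pos h, if_neg (not_not.mpr h), zero_zsmul]
      · rw [if_neg h, if_pos h, one_zsmul]
    simp_rw [h1]
    rw [← Finset.sum_filter]
    refine Finset.sum_nbij (fun σ ↦ (qσ σ : ℤ × ℤ × ℤ)) (fun σ hσ ↦ ?_) (fun σ hσ σ' hσ' h ↦ ?_) (fun Q hQ ↦ ?_)
      (fun _ _ ↦ rfl)
    · rw [Finset.mem_filter] at hσ ⊢
      exact ⟨(qσ σ).2, (hcoset σ).mp hσ.2⟩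
    · exact hinjq σ σ' (Subtype.ext h)
    · obtain ⟨hQ, δ, hδ⟩ := Finset.mem_filter.mp (Finset.mem_coe.mp hQ)
      -- the automorphism of class `δ²·Θ⁻¹σ₀`
      refine ⟨Θ (δ ^ 2 * Θ.symm σ₀), Finset.mem_coe.mpr (Finset.mem_filter.mpr ⟨Finset.mem_univ _, ?_⟩), ?_⟩
      · refine (hcoset _).mpr ⟨δ, ?_⟩
        rw [(hqσ _).1, MulEquiv.symm_apply_apply, hγ₀, mul_assoc]
      · have hcl : heegnerFormClass hK (qσ (Θ (δ ^ 2 * Θ.symm σ₀)) : ℤ × ℤ × ℤ) = heegnerFormClass hK Q := by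
          rw [(hqσ _).1, MulEquiv.symm_apply_apply, hδ, hγ₀, mul_assoc]
        exact heegnerFormClass_injOn_reps hK H (qσ _).2 hQ hcl
  ------------------------------------------------------------------ Gross's summed reflection law on the coset, parity
  have hW : IsFrickeEigen (cm7.conductorNorm ℤ) D₀.f (((-1 : ℤ)) : ℂ) := by
    push_cast
    exact isFrickeEigen_neg_one_of_rootNumber_eq_one cm7 D₀.isNewformOf hw
  have hν : ∃ μ, heegnerFormClass hK ((cm7.conductorNorm ℤ : ℤ), H.β,
      (H.β ^ 2 - NumberField.discr K) / (4 * cm7.conductorNorm ℤ)) = μ ^ 2 := by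
    have h7 : cm7.conductorNorm ℤ = 7 ^ 2 := by rw [conductorNorm_cm7]; norm_num
    haveI : NeZero (7 : ℕ) := ⟨by norm_num⟩
    refine ⟨_, ((heegnerFormClass_levelForm_eq_datum hK hND H q₁.2).symm.trans
      (heegnerFormClass_levelForm_eq_sq hK h7 hND (H.mem_heegnerForms _ q₁.2).1))⟩
  have hlaw := conjPoint_sum_φ_heegnerTau_sqCoset hK hH D₀ H hW (Or.inr rfl) γ₀ hν
  have hoddc : Odd (H.reps.filter (fun Q ↦ ∃ δ, heegnerFormClass hK Q = δ ^ 2 * γ₀)).card := by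
    rw [card_filter_sqCoset_eq_natCard_range hK hH D₀ H ι γ₀]
    exact hodd
  have hTT : (H.reps.filter (fun Q ↦ ∃ δ, heegnerFormClass hK Q = δ ^ 2 * γ₀)).card • D₀.cuspZeroPoint =
      Affine.Point.some 2 (-1) (nonsingular_cm7_baseChange_two_neg_one ℂ) := by
    obtain ⟨h, hh⟩ := h0
    have hh' : D₀.cuspZeroPoint = Affine.Point.some 2 (-1) (nonsingular_cm7_baseChange_two_neg_one ℂ) := hh
    have hz := zsmul_eq_self_of_odd_of_add_self_eq_zero (cm7_twoTorsion_add_self ℂ)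
      (m := ((H.reps.filter (fun Q ↦ ∃ δ, heegnerFormClass hK Q = δ ^ 2 * γ₀)).card : ℤ)) (by exact_mod_cast hoddc)
    rw [natCast_zsmul] at hz
    rw [hh']
    exact hz
  rw [hTT, neg_one_zsmul, neg_one_zsmul, sub_neg_eq_add] at hlaw
  ------------------------------------------------------------------ conclusion in `E(ℂ)`
  apply Affine.Point.map_injective (f := (ringClassField K ι 1).subtype.toRatAlgHom)
  rw [map_add, map_subtype_map_conj τ hτ, hsum, hlaw, ← add_assoc, add_neg_cancel, zero_add]
  exact (map_cm7_twoTorsion (ringClassField K ι 1).subtype).symm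


/-! ## §2 The quarter `ℓ ≡ 3 (mod 8)`: the class-group inputs discharged by GENUS-SQUARES-ODD(−8ℓ) -/

/-- **(B1) OF THEOREM A‴: `Ψ⁻ + τΨ⁻ = T`** in `X₀(49)(K[1])` for `K = ℚ(√−2ℓ)`, `ℓ ≡ 3 (mod 8)` prime with `(ℓ/7) = −1` — §1 with
`[Cl : Cl²] = 2` (`μ(−8ℓ) = 2`, `assignedCharCount_neg_eight_mul_prime_threeModEight`, tree `index_range_sq_classGroup_QO`) and `#Cl²`
ODD (`odd_natCard_range_powMonoidHom_two_of_discr_eq_neg_eight_mul`, K4) BY NAME. Inputs BY NAME: `w(49a1) = +1` (`hw`), (T-φ0) (`h0`).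
[cite: Gross1984, §5 (5.2)–(5.3)] [cite: GrossLMS1991, Prop. 5.3] [cite: Darmon2004, Thm. 3.7 and Prop. 3.11] [cite: Cox2013, §3.B Thm. 3.15] -/
theorem halfTrace_add_map_conj_eq_twoTorsion_negEightPrime_threeModEight (hK : IsImaginaryQuadratic K) {l : ℕ} (hl : l.Prime)
    (hl8 : l % 8 = 3) (hl7 : jacobiSym l 7 = -1) (hdK : NumberField.discr K = -(8 * (l : ℤ))) {N : ℕ} [NeZero N]
    (hN : cm7.conductorNorm ℤ = N) (D₀ : ModularParametrizationData cm7 N) (hw : cm7.rootNumber = 1)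
    (h0 : ∃ h, D₀.cuspZeroPoint = Affine.Point.some 2 (-1) h) {β : ℤ} (d : KolyvaginHeegnerData D₀ β ι 1)
    {r₀ : ringClassField K ι 1} (hr : (r₀ : ℂ) ^ 2 = -(l : ℂ)) (τ : ringClassField K ι 1 ≃ₐ[ℚ] ringClassField K ι 1)
    (hτ : ∀ x : ringClassField K ι 1, ((τ x : ringClassField K ι 1) : ℂ) = starRingEnd ℂ x)
    [hdec : DecidableEq (ringClassField K ι 1)] :
    (∑ σ : ringClassField K ι 1 ≃ₐ[K] ringClassField K ι 1,
        (if σ r₀ = r₀ then (0 : ℤ) else 1) • Affine.Point.map (σ : ringClassField K ι 1 →ₐ[K] ringClassField K ι 1) d.y) +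
      Affine.Point.map (τ : ringClassField K ι 1 →ₐ[ℚ] ringClassField K ι 1)
        (∑ σ : ringClassField K ι 1 ≃ₐ[K] ringClassField K ι 1,
          (if σ r₀ = r₀ then (0 : ℤ) else 1) • Affine.Point.map (σ : ringClassField K ι 1 →ₐ[K] ringClassField K ι 1) d.y) =
      Affine.Point.some 2 (-1) (nonsingular_cm7_baseChange_two_neg_one (ringClassField K ι 1)) := by
  have hD4 : hK.negDiscr.D % 4 = 0 ∨ hK.negDiscr.D % 4 = 1 := Or.inl (by rw [hK.negDiscr_D, hdK]; omega)
  have hΔ : hK.negDiscr.D = -(8 * (l : ℤ)) := by rw [hK.negDiscr_D, hdK]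
  have hidx : (powMonoidHom 2 : ClassGroup (OrderCl.QO hK.negDiscr) →* ClassGroup (OrderCl.QO hK.negDiscr)).range.index = 2 := by
    rw [Literature.NumberTheory.QuadraticFields.Quadratic.index_range_sq_classGroup_QO hK.negDiscr hD4,
      assignedCharCount_neg_eight_mul_prime_threeModEight hK.negDiscr hl hl8 hΔ]
    norm_num
  exact halfTrace_add_map_conj_eq_twoTorsion_of_odd ι hK hl hl7 hdK hN D₀ hw h0 d hr τ hτ hidx
    (odd_natCard_range_powMonoidHom_two_of_discr_eq_neg_eight_mul K hK hl hl8 hdK)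

end HalfTrace

end Summit.BirchSwinnertonDyer.BirchSwinnertonDyer.Theorems.GoldfeldGoodTwists

end
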